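import Summits.CriticalPhenomena.PercolationContinuityZ3.Theorems.PercNearOneGluingNoHeavyLowerTailThreePartitionJunta3
import Summits.CriticalPhenomena.PercolationContinuityZ3.Theorems.PercNearOneGluingNoHeavyLowerTailThreePartitionOneOrComb
import Summits.CriticalPhenomena.PercolationContinuityZ3.Theorems.PercNearOneGluingNoHeavyLowerTailThreePartitionGridPrincipal
import Summits.CriticalPhenomena.PercolationContinuityZ3.Theorems.PercNearOneGluingNoHeavyLowerTailThreePartitionPrincipalCombPos
import HarnessLib.Audit

/-!
# `NoHeavyLowerTail` (crux stmt-CriticalPhenomena-4575), master-family hierarchy P3 (gen 37): COMB-C3 for every event determined by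
# at most THREE coordinates — Sahi's `E₃(μ_p; 1_U, 1_V, 1_W) ` is comb-positive whenever one of `U, V, W` is a 3-junta

Support file (seat `prim-masterthm-p3`; `--supports stmt-CriticalPhenomena-4575`; memo
`run/shared/lean/prim/prim-masterthm/FROM-prim-masterthm-p3-g37-ONE-DISJUNCTION.md` §8).  From the 3-JUNTA THEOREM (`…ThreePartitionJunta3`,
`threePartNT_nonneg_of_determined3`) to the general form and the comb bridge:
* `DeterminedBy S 𝒰` (membership depends only on the trace on `S`); `threePartNT_nonneg_of_determinedBy` — `N_τ(𝒰, 𝒱, 𝒲) ≥ 0` whenever one of the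
  three increasing events is determined by a finset of `≤ 3` coordinates (pad to three distinct points; on ground types with `≤ 2` points every up-set is
  `∅ / ⊤ / principal / a disjunction` — known classes: `threePartNT_nonneg_of_card_le_two`);
* sections of an event determined by `S` are determined by the active part of `S` (`determinedBy_secFam`);
* **`combPos_sahiE_three_junta3`**, `sahiE_three_junta3_nonneg`: COMB-C3 ⟹ Sahi's `E₃ ≥ 0` under every product measure for (U, V, W) with `U`
  determined by `≤ 3` coordinates and `V, W` ARBITRARY increasing; example `combPos_sahiE_three_maj3` (majority of three coins).
HONEST LABEL: a new kernel class of COMB-C3 (any monotone function of three coins × arbitrary × arbitrary); general conjecture OPEN. [this work]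
-/

noncomputable section

open Finset
open scoped symmDiff Classical

namespace Summit.CriticalPhenomena.PercolationContinuityZ3.Theorems.ThreePartition

variable {ι : Type*} [Fintype ι]

/-! ## Ground types with at most two points: every up-set is `∅`, `⊤`, `{⊤}` or a disjunction -/

omit [Fintype ι] in
/-- On a type with at most two points (given as: every set is `∅`, `univ` or a singleton), an up-set is `∅`, `⊤`, `{⊤} = ↑univ` or a
disjunction `orFam S`. [this work] -/
theorem upperSet_cases_of_small (hsmall : ∀ x : Set ι, x = ∅ ∨ x = Set.univ ∨ ∃ a, x = {a}) {𝒰 : Set (Set ι)} (h𝒰 : IsUpperSet 𝒰) :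
    𝒰 = ∅ ∨ 𝒰 = Set.univ ∨ 𝒰 = Set.Ici Set.univ ∨ ∃ S : Set ι, 𝒰 = orFam S := by
  by_cases he : (∅ : Set ι) ∈ 𝒰
  · exact Or.inr (Or.inl (Set.eq_univ_of_forall fun x => h𝒰 (Set.empty_subset x) he))
  by_cases hne : 𝒰 = ∅
  · exact Or.inl hne
  have huniv : Set.univ ∈ 𝒰 := by
    obtain ⟨x, hx⟩ := Set.nonempty_iff_ne_empty.2 hne
    exact h𝒰 (Set.subset_univ x) hx
  by_cases hS : ∃ a : ι, ({a} : Set ι) ∈ 𝒰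
  · right; right; right
    refine ⟨{a | ({a} : Set ι) ∈ 𝒰}, Set.ext fun x => ⟨fun hx => ?_, fun hx => ?_⟩⟩
    · rw [mem_orFam]
      rcases hsmall x with rfl | rfl | ⟨a, rfl⟩
      · exact absurd hx he
      · obtain ⟨a, ha⟩ := hS; exact ⟨a, Set.mem_univ a, ha⟩
      · exact ⟨a, rfl, hx⟩
    · rw [mem_orFam] at hx
      obtain ⟨a, hax, ha⟩ := hx
      exact h𝒰 (Set.singleton_subset_iff.2 hax) ha
  · right; right; left
    push Not at hS
    refine Set.ext fun x => ⟨fun hx => ?_, fun hx => ?_⟩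
    · rcases hsmall x with rfl | rfl | ⟨a, rfl⟩
      · exact absurd hx he
      · exact Set.mem_Ici.2 subset_rfl
      · exact absurd hx (hS a)
    · rw [Set.mem_Ici, Set.univ_subset_iff] at hx
      rw [hx]; exact huniv

/-- A type of cardinality `≤ 2` is small in the above sense. [this work] -/
theorem small_of_card_le_two (h2 : Fintype.card ι ≤ 2) (x : Set ι) : x = ∅ ∨ x = Set.univ ∨ ∃ a, x = {a} := by
  rcases Set.eq_empty_or_nonempty x with rfl | ⟨a, ha⟩
  · exact Or.inl rfl
  by_cases hs : x = {a}
  · exact Or.inr (Or.inr ⟨a, hs⟩)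
  right; left
  have hb : ∃ b ∈ x, b ≠ a := by
    by_contra hcon; push Not at hcon
    exact hs (Set.eq_singleton_iff_unique_mem.2 ⟨ha, hcon⟩)
  obtain ⟨b, hb, hba⟩ := hb
  refine Set.eq_univ_of_forall fun c => ?_
  by_contra hc
  have hca : c ≠ a := fun h => hc (h ▸ ha)
  have hcb : c ≠ b := fun h => hc (h ▸ hb)
  have h3 : ({a, b, c} : Finset ι).card = 3 := Finset.card_eq_three.2 ⟨a, b, c, hba.symm, hca.symm, hcb.symm, rfl⟩
  have := Finset.card_le_card (Finset.subset_univ ({a, b, c} : Finset ι))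
  rw [h3, Finset.card_univ] at this
  omega

/-- **Twisted three-partition positivity on ground types with at most two points** (every up-set is `∅`, `⊤`, principal or a disjunction:
known classes). [this work] -/
theorem threePartNT_nonneg_of_card_le_two (h2 : Fintype.card ι ≤ 2) (τ : Set ι) {𝒰 𝒱 𝒲 : Set (Set ι)} (h𝒰 : IsUpperSet 𝒰)
    (h𝒱 : IsUpperSet 𝒱) (h𝒲 : IsUpperSet 𝒲) : 0 ≤ threePartNT τ 𝒰 𝒱 𝒲 := by
  rcases upperSet_cases_of_small (small_of_card_le_two h2) h𝒰 with rfl | rfl | rfl | ⟨S, rfl⟩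
  · rw [threePartNT_empty_left]
  · exact threePartNT_nonneg_of_nested τ h𝒰 h𝒱 h𝒲 (Or.inr (Or.inr (Or.inr (Or.inr (Or.inr (Set.subset_univ _))))))
  · exact threePartNT_nonneg_of_Ici τ h𝒰 h𝒱 h𝒲 (Or.inr (Or.inr ⟨_, rfl⟩))
  · exact threePartNT_nonneg_of_or τ h𝒰 h𝒱 h𝒲 (Or.inl ⟨S, rfl⟩)

/-! ## Events determined by a set of coordinates, and their sections -/

omit [Fintype ι] in
/-- `𝒰` is DETERMINED by the coordinates in `S`: membership depends only on the trace on `S`. [this work] -/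
def DeterminedBy (S : Set ι) (𝒰 : Set (Set ι)) : Prop := ∀ x, x ∈ 𝒰 ↔ x ∩ S ∈ 𝒰

omit [Fintype ι] in
/-- Determined by `S` implies determined by any `T ⊇ S`. [this work] -/
theorem DeterminedBy.mono {S T : Set ι} {𝒰 : Set (Set ι)} (h : DeterminedBy S 𝒰) (hST : S ⊆ T) : DeterminedBy T 𝒰 := by
  intro x
  rw [h x, h (x ∩ T), Set.inter_assoc, Set.inter_eq_right.2 hST]

section Sections

open Literature.Combinatorics.Sahi2008
open SahiComb

variable {α : Type} [Fintype α]

/-- The active coordinates (at profile `j`) lying in `S`. [this work] -/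
def actIn (j : α → ℕ) (S : Finset α) : Finset (Act j) := univ.filter fun e => e.1 ∈ S

/-- `actIn j S` has at most `#S` elements. [this work] -/
theorem card_actIn_le (j : α → ℕ) (S : Finset α) : (actIn j S).card ≤ S.card := by
  refine Finset.card_le_card_of_injOn (fun e => e.1) (fun e he => ?_) (fun e₁ _ e₂ _ h => Subtype.ext h)
  unfold actIn at he
  exact (Finset.mem_filter.1 he).2

omit [Fintype α] in
/-- Lifts of sets of active coordinates with the same trace on `actIn j S` have the same trace on `S`. [this work] -/
theorem liftSet_inter_eq [Fintype α] (j : α → ℕ) (S : Finset α) (T : Set (Act j)) :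
    liftSet j (T ∩ ↑(actIn j S)) ∩ ↑S = liftSet j T ∩ ↑S := by
  ext e
  simp only [Set.mem_inter_iff, Finset.mem_coe]
  by_cases ha : j e = 1 ∨ j e = 2
  · rw [mem_liftSet_iff ha, mem_liftSet_iff ha, Set.mem_inter_iff, Finset.mem_coe]
    unfold actIn
    simp only [Finset.mem_filter, Finset.mem_univ, true_and]
    tauto
  · rw [mem_liftSet_iff_of_not ha, mem_liftSet_iff_of_not ha]

/-- **Sections of an event determined by `S` are determined by the active part of `S`.** [this work] -/
theorem determinedBy_secFam (j : α → ℕ) {S : Finset α} {U : Set (Set α)} (hU : DeterminedBy (↑S) U) :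
    DeterminedBy (↑(actIn j S) : Set (Act j)) (secFam j U) := by
  intro T
  show liftSet j T ∈ U ↔ liftSet j (T ∩ ↑(actIn j S)) ∈ U
  rw [hU (liftSet j T), hU (liftSet j (T ∩ ↑(actIn j S))), liftSet_inter_eq]

end Sections

/-! ## `N ≥ 0` for events determined by at most three coordinates -/

/-- **`N_τ(𝒰; A, B) ≥ 0` for every increasing `𝒰` determined by a finset of at most three coordinates** (first slot). [this work] -/
theorem threePartNT_nonneg_of_determinedBy {S : Finset ι} (hS : S.card ≤ 3) {𝒰 A B : Set (Set ι)} (h𝒰 : IsUpperSet 𝒰)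
    (hdet : DeterminedBy (↑S) 𝒰) (τ : Set ι) (hA : IsUpperSet A) (hB : IsUpperSet B) : 0 ≤ threePartNT τ 𝒰 A B := by
  by_cases h3 : 3 ≤ Fintype.card ι
  · obtain ⟨T, hST, -, hT⟩ := Finset.exists_subsuperset_card_eq (Finset.subset_univ S) hS (by rwa [Finset.card_univ])
    obtain ⟨p, q, r, hpq, hpr, hqr, rfl⟩ := Finset.card_eq_three.1 hT
    have hdet' : DeterminedBy ({p, q, r} : Set ι) 𝒰 := by
      have := hdet.mono (Finset.coe_subset.2 hST)
      rwa [Finset.coe_insert, Finset.coe_insert, Finset.coe_singleton] at this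
    exact threePartNT_nonneg_of_determined3 ⟨hpq, hpr, hqr⟩ h𝒰 hdet' τ hA hB
  · exact threePartNT_nonneg_of_card_le_two (by omega) τ h𝒰 hA hB

/-- **Any slot.** [this work] -/
theorem threePartNT_nonneg_of_determinedBy₃ (τ : Set ι) {𝒰 𝒱 𝒲 : Set (Set ι)} (h𝒰 : IsUpperSet 𝒰) (h𝒱 : IsUpperSet 𝒱) (h𝒲 : IsUpperSet 𝒲)
    (h : ∃ S : Finset ι, S.card ≤ 3 ∧ (DeterminedBy (↑S) 𝒰 ∨ DeterminedBy (↑S) 𝒱 ∨ DeterminedBy (↑S) 𝒲)) :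
    0 ≤ threePartNT τ 𝒰 𝒱 𝒲 := by
  obtain ⟨S, hS, h | h | h⟩ := h
  · exact threePartNT_nonneg_of_determinedBy hS h𝒰 h τ h𝒱 h𝒲
  · rw [threePartNT_swap12]; exact threePartNT_nonneg_of_determinedBy hS h𝒱 h τ h𝒰 h𝒲
  · rw [threePartNT_swap23, threePartNT_swap12]; exact threePartNT_nonneg_of_determinedBy hS h𝒲 h τ h𝒰 h𝒱

/-! ## COMB-C3 for a 3-junta and two arbitrary increasing events -/

section Comb

open Literature.Combinatorics.Sahi2008
open SahiComb

variable {α : Type} [Fintype α]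

/-- **COMB-C3 for (3-junta, arbitrary, arbitrary)**: if the increasing event `U` is determined by a finset `S` of at most three coordinates, then for all
increasing `V, W`, Sahi's `E₃(μ_p; 1_U, 1_V, 1_W)` is a nonnegative combination of the degree-3 tensor-Bernstein basis on the product cube. [this work] -/
theorem combPos_sahiE_three_junta3 {S : Finset α} (hS : S.card ≤ 3) {U V W : Set (Set α)} (hU : IsUpperSet U) (hdet : DeterminedBy (↑S) U)
    (hV : IsUpperSet V) (hW : IsUpperSet W) :
    CombPos (fun _ : α => 3) (fun p => sahiE (bernoulliWeight p) 3 ![Literature.Probability.Percolation.DecisionTree.ind U,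
      Literature.Probability.Percolation.DecisionTree.ind V, Literature.Probability.Percolation.DecisionTree.ind W]) := by
  refine combPos_sahiE_three_of_combCoef3_nonneg fun j => ?_
  by_cases hj : ∀ e, j e ≤ 3
  · rw [combCoef3_eq_threePartNT U V W hj]
    exact_mod_cast threePartNT_nonneg_of_determinedBy ((card_actIn_le j S).trans hS) (isUpperSet_secFam j hU) (determinedBy_secFam j hdet)
      (twist j) (isUpperSet_secFam j hV) (isUpperSet_secFam j hW)
  · rw [combCoef3_eq_zero_of_not_le U V W hj]

/-- **Sahi's `E₃ ≥ 0` for (3-junta, arbitrary, arbitrary) under every product measure.** [this work] -/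
theorem sahiE_three_junta3_nonneg {S : Finset α} (hS : S.card ≤ 3) {U V W : Set (Set α)} (hU : IsUpperSet U) (hdet : DeterminedBy (↑S) U)
    (hV : IsUpperSet V) (hW : IsUpperSet W) (p : α → unitInterval) :
    0 ≤ sahiE (bernoulliWeight p) 3 ![Literature.Probability.Percolation.DecisionTree.ind U,
      Literature.Probability.Percolation.DecisionTree.ind V, Literature.Probability.Percolation.DecisionTree.ind W] :=
  (combPos_sahiE_three_junta3 hS hU hdet hV hW).nonneg p

omit [Fintype α] in
/-- The majority of three coins is determined by those three coordinates. [this work] -/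
theorem determinedBy_majFam (p q r : α) : DeterminedBy (↑({p, q, r} : Finset α)) (majFam p q r) := by
  intro x
  rw [Finset.coe_insert, Finset.coe_insert, Finset.coe_singleton]
  exact majFam_determined p q r x

/-- **Example: MAJORITY OF THREE COINS.** Sahi's `E₃(μ_p; 1_{MAJ₃(p,q,r)}, 1_V, 1_W) ` is comb-positive for all increasing `V, W`
(`p, q, r` need not be distinct). [this work] -/
theorem combPos_sahiE_three_maj3 (p q r : α) {V W : Set (Set α)} (hV : IsUpperSet V) (hW : IsUpperSet W) :
    CombPos (fun _ : α => 3) (fun μ => sahiE (bernoulliWeight μ) 3 ![Literature.Probability.Percolation.DecisionTree.ind (majFam p q r),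
      Literature.Probability.Percolation.DecisionTree.ind V, Literature.Probability.Percolation.DecisionTree.ind W]) :=
  combPos_sahiE_three_junta3 Finset.card_le_three (isUpperSet_majFam p q r) (determinedBy_majFam p q r) hV hW

end Comb

end Summit.CriticalPhenomena.PercolationContinuityZ3.Theorems.ThreePartition

end
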